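/-
Copyright: public-audit package `pub-balaban` (b2b-balaban), seat pv28-g14. Released under Apache 2.0 like Mathlib.
-/
import Literature.MathematicalPhysics.QuantumFieldTheory.Balaban1983to89.T4WilsonGaugeFlatDirection

/-!
# T4 — caveat (N1-pos) of the gnomonic window plug, DISJOINT CASE: on a PLAQUETTE-DISJOINT multi-link fibre the
# Wilson exponent is multi-link quaternion-affine, its pull-back has a block-diagonal Hessian and block-orthogonal
# gradient, and the ONE-LINK window plug goes through with the PER-LINK window restriction `3S'² ≤ ρ²`

* Value = kernel certificate (lattice bookkeeping + finite-dimensional calculus); NOT summit progress; NOT continuum;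
  NOT Clay.  0 [cite], 0 [model]: everything here is [folklore]; NO printed sentence is asserted and nothing
  internally minted is cited (ABSOLUTE RULE).  Cell row T4-O3.E-iii-b-G7 (BL-window), lineage pv28, record
  `t4/T4-EST-O3Eiiib-G7.md`; this leaf types item (N1-pos) of GAPS G-pv28g14-1 in the DISJOINT case.
* THE QUESTION (N1-pos).  The plug `T4CubeConvexExtension.mem_respDom_of_gnoChart_local` is multi-link (any finite
  link set `s`, `e : ↥s × Fin 3 ≃ Fin n`, modulus `λ = gnoKappa S' + μ` with `hB₀ : HessianBoundOn g₀ [-S',S']ⁿ μ`,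
  `agree₀ : g₀ x = −h(u₀ ←ₛ φ(x))`, gradient gap `hgap`), but the lineage DISCHARGED its action binders only for ONE
  link (`T4GnomonicWilsonHessian` … `T4WilsonStapleDeviation`, window `n·S'² ≤ ρ²`, `n = 3`), and
  `T4WilsonGaugeFlatDirection` showed that NO `μ > 0` exists on fibres containing the star of a site.  Where does a
  `β`-gain survive on several links?
* THE ANSWER TYPED HERE (positive edge, simplest honest class).  On every PLAQUETTE-DISJOINT link set `s` — no
  plaquette has two of its four letters in `s` (`PlaqDisjoint s`; such an `s` contains no star as soon as `d ≥ 2`,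
  `not_containsStar_of_plaqDisjoint`, consistent with the no-go) — for the `k = 0` Wilson exponent
  `h = fun U => c * wilsonAction w U` (Gibbs sign `c = −β`):
  (1) `mul_wilsonAction_updateFinset` (§4) — THE MULTI-AFFINE EXPANSION about ANY exterior `u`:
      `c·A_w(u ←ₛ y) = c·A_w(u) + Σ_{b ∈ s} Re((q(y_b) − q(u b)) · wilsonDatum c w u b)` (Finset induction on the
      one-link `T4WilsonLinkAffine.linkAffine_wilsonAction` at the partially reset fields `resetOff`; the datum of a
      link does not see the other links of `s` — `wilsonDatum_eq_of_agree` (§3), via `stapleDist = 0` of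
      `T4WilsonStapleDeviation`);
  (2) `disjRep s e u₀ u c w` (§5) — THE `C²` REPRESENTATIVE on `ℝⁿ` of `x ↦ −c·A_w(u ←ₛ φ_{u₀,e}(x))`: a constant
      plus the SUM over `b ∈ s` of the one-link gnomonic profiles `F_{Re c_b, Im c_b}` of `T4GnomonicWilsonHessian` in
      the link's OWN three coordinates `π_b x` (`blockProj`), `c_b = wilsonDatum c w u b · su2Quat(u₀ b)`;
      `disjRep_eq` (agreement on all of `ℝⁿ` — the plug's `agree₀` for `u = u₀`, `agree₁` for the actual exterior),
      `contDiff_disjRep`, `disjRep_sub` (the difference of the two is a block sum with the difference data);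
      `disjRep_singleton` (§7): for `s = {b}` it IS `T4GnomonicWilsonHessian.linkRep` with the Wilson datum;
  (3) BLOCK CALCULUS (§1, generic `e : ι × Fin m ≃ Fin n`, no lattice): `fderiv_fderiv_comp_clm`
      (`D²(f∘L)(x)(w,w) = D²f(Lx)(Lw,Lw)` by the line-function trick of `T4CubeConvexExtension.hasDerivAt_fderiv_line`),
      `fderiv_fderiv_blockSum` / `fderiv_blockSum` (second / first derivative of `C + Σ_b f_b∘π_b` block by block),
      `sum_blockProj_dotProduct` (`Σ_b π_b w · π_b w' = w · w'`), `hessianBoundOn_blockSum` (`HessianBoundOn f_b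
      [-S,S]ᵐ μ_b`, `μ ≤ μ_b` ⟹ `HessianBoundOn (C + Σ_b f_b∘π_b) [-S,S]ⁿ μ`), `sq_sum_le_sum_sq_mul_sum` (weighted
      Cauchy–Schwarz) and `coordGradient_blockSum_sq_le` (`(Df_b(π_b x)w)² ≤ G_b²|w|²` ⟹ `|∇(C + Σ_b f_b∘π_b)(x)|² ≤
      Σ_b G_b²`);
  (4) THE HESSIAN SIDE `hessianBoundOn_disjRep_of_blocks`, `hessianBoundOn_disjRep` (exterior `u`, chart centre `u₀`:
      the one-link Wilson numbers of `T4WilsonDatumBounds` PER LINK — small field `reTr ≥ 1 − ε` of the HYBRID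
      plaquettes `(u ←_b u₀ b)(∂p)` through the links of `s`, `0 ≤ β·w`, `0 ≤ ε ≤ 1`, `0 ≤ ρ`, `2ρ² ≤ 1` and the
      PER-LINK window `3·S'² ≤ ρ²` ⟹ `HessianBoundOn (disjRep s e u₀ u (−β) w) [-S',S']ⁿ μ` with the ONE-LINK modulus
      `μ = gnoMu(β·w·2(d−1)(1−ε), β·w·2(d−1)√(2ε), ρ)`), `hessianBoundOn_disjRep_self` (`u = u₀`);
      THE GRADIENT SIDE `coordGradient_disjRep_sub_sq_le` (`|∇(g₁ − g₀)(x)|² ≤ Σ_b (|a_b(u) − a_b(u₀)|(1+ρ+ρ²))²` on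
      the per-link balls) and `coordGradient_disjRep_sub_sq_le_stapleDist` (`≤ (β·w·(1+ρ+ρ²)·Σ_b stapleDist b u₀ u)²`);
  (5) THE PLUG DISCHARGED (§6): `mem_respDom_of_wilson_disjoint_datum` (binders of the one-link
      `T4WilsonStapleDeviation.mem_respDom_of_wilson_smallField_datum` with `{b}` ↦ a plaquette-disjoint `s`,
      `n·S'² ≤ ρ²` ↦ `3·S'² ≤ ρ²`, budget `β·w·(1+ρ+ρ²)·Σ_{b∈s} stapleDist b u₀ u ≤ bH·dev u`; SAME modulus
      `gnoKappa S' + 7/25·(β·w·2(d−1))`) and `mem_respDom_of_wilson_disjoint` (`dev := Σ_{b∈s} stapleDist b u₀`, slope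
      `β·w·(1+ρ+ρ²)/√λ`, reference-exterior hypotheses only: `reTr(u₀(∂p)) ≥ 1 − ε` on the plaquettes through `s` and
      `ε + Σ_{b∈s} stapleDist b u₀ u ≤ 1/8`).  The point: neither the window restriction nor the modulus degrades with
      the number of links — each block sees only its own radius and its own staples.

## Honest caveats

* WHAT THIS DOES NOT DO.  (a) DISJOINT links only: star-free link sets with shared plaquettes (e.g. complements of
  maximal trees) have genuine cross terms in both the Hessian and the expansion (Gershgorin-type losses; the floor may
  be negative for dense `s`) — untouched; fibres containing a star are excluded by `T4WilsonGaugeFlatDirection`.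
  (b) The deviation functional is the SUM `Σ_{b∈s} stapleDist b u₀ u` and the hybrid small-field input is
  `ε + Σ ≤ 1/8` (a per-link `max` would do for the small field; the sum is what the gradient gap produces) — for
  large `s` this is a strong closeness requirement on `u`; nothing here sizes it.  (c) `k = 0` Wilson form, `SU(2)`
  only (RANK), quaternion model; the measurability / integrability / `hK` / insert binders of the plug are carried,
  not discharged.  (d) No family of plaquette-disjoint link sets of any prescribed size is exhibited
  (`plaqDisjoint_singleton`, `PlaqDisjoint.subset` only); producing the disjoint fibres a consumer integrates over is
  consumer-side.  Nothing printed is read or asserted.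
-/


noncomputable section

open scoped Quaternion

namespace Literature.MathematicalPhysics.QuantumFieldTheory.Balaban1983to89.T4WilsonDisjointLinks

open Literature.MathematicalPhysics.QuantumLattice (su2Quat norm_su2Quat)
open Literature.Probability.Distributions (coordGradient)
open Function (updateFinset)
open T4CubePoincare (cube mem_cube_iff)
open T4CubeChartGnomonic (SU2 gnoChart gnoFibreChart windowDensity)
open T4CubeConvexExtension (HessianBoundOn hessianBoundOn_iff_fderiv hasDerivAt_fderiv_line gnoKappa cube_subset_cube
  mem_respDom_of_gnoChart_local)
open T4GnomonicWilsonHessian (gnoProfile imVec gnoMu contDiff_gnoProfile hessianBoundOn_gnoProfile_cube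
  gnoMu_mono_left re_su2Quat_gnoChart_mul imVec_dotProduct_self imVec_sub gnoProfile_sub sq_fderiv_gnoProfile_le
  coordGradient_sq_le_of_sq_fderiv_le dotProduct_self_le_of_mem_cube linkRep linkCoord sum_coe_singleton
  gnoProfile_linkVec)
open T4WilsonLinkAffine
open T4WilsonDatumBounds
open T4WilsonSmallFieldNumerics (IsStaple gnoMu_smallField_ge gnoKappa_window_ge)
open T4WilsonStapleDeviation (stapleDist stapleDist_nonneg stapleDist_le_of_staple norm_wilsonDatum_sub_le_stapleDist
  reTr_update_ge_of_stapleDist)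
open T4WilsonGaugeFlatDirection (ContainsStar)
open T4CovarianceResponse (respDom)

/-! ## §1  Block calculus on `ℝⁿ = ⊕_b ℝᵐ` (generic; no lattice) -/

section Blocks

variable {ι : Type*} {m n : ℕ}

/-- THE BLOCK PROJECTION `π_b : ℝⁿ → ℝᵐ`, `(π_b x)_i = x_{e(b,i)}`, as a continuous linear map. [folklore] -/
def blockProj (e : ι × Fin m ≃ Fin n) (b : ι) : (Fin n → ℝ) →L[ℝ] (Fin m → ℝ) :=
  ContinuousLinearMap.pi fun i => ContinuousLinearMap.proj (e (b, i))

/-- `(π_b x)_i = x_{e(b,i)}`. [folklore] -/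
@[simp] theorem blockProj_apply (e : ι × Fin m ≃ Fin n) (b : ι) (x : Fin n → ℝ) (i : Fin m) :
    blockProj e b x i = x (e (b, i)) := rfl

/-- THE BLOCKS ARE ORTHOGONAL AND EXHAUST `ℝⁿ`: `Σ_b π_b w · π_b w' = w · w'` (`e` is a bijection). [folklore] -/
theorem sum_blockProj_dotProduct [Fintype ι] (e : ι × Fin m ≃ Fin n) (w w' : Fin n → ℝ) :
    ∑ b, blockProj e b w ⬝ᵥ blockProj e b w' = w ⬝ᵥ w' := by
  simp only [dotProduct, blockProj_apply]
  rw [← Fintype.sum_prod_type (fun bi : ι × Fin m => w (e bi) * w' (e bi))]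
  exact e.sum_comp (fun k => w k * w' k)

/-- A block of a point of the cube `[-S,S]ⁿ` lies in the cube `[-S,S]ᵐ` (the PER-BLOCK radius does not grow with the
number of blocks). [folklore] -/
theorem blockProj_mem_cube (e : ι × Fin m ≃ Fin n) (b : ι) {S : ℝ} {x : Fin n → ℝ} (hx : x ∈ cube n S) :
    blockProj e b x ∈ cube m S := by
  rw [mem_cube_iff] at hx ⊢
  intro i
  rw [blockProj_apply]
  exact hx _

/-- **SECOND DERIVATIVE OF A COMPOSITION WITH A LINEAR MAP** along `(w,w)`: `D²(f∘L)(x)(w,w) = D²f(Lx)(Lw,Lw)` for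
`f ∈ C²` — the line functions `t ↦ D(f∘L)(x+tw)w` and `t ↦ Df(Lx+tLw)(Lw)` coincide (chain rule), and their
derivatives at `0` are the two sides (`hasDerivAt_fderiv_line`, uniqueness). [folklore] -/
theorem fderiv_fderiv_comp_clm {f : (Fin m → ℝ) → ℝ} (hf : ContDiff ℝ 2 f) (L : (Fin n → ℝ) →L[ℝ] (Fin m → ℝ))
    (x w : Fin n → ℝ) :
    fderiv ℝ (fderiv ℝ (f ∘ ⇑L)) x w w = fderiv ℝ (fderiv ℝ f) (L x) (L w) (L w) := by
  have hg : ContDiff ℝ 2 (f ∘ ⇑L) := hf.comp L.contDiff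
  have h1 := hasDerivAt_fderiv_line hg x w
  have h2 := hasDerivAt_fderiv_line hf (L x) (L w)
  have hfun : (fun t : ℝ => fderiv ℝ (f ∘ ⇑L) (x + t • w) w) = fun t : ℝ => fderiv ℝ f (L x + t • L w) (L w) := by
    funext t
    have hd : DifferentiableAt ℝ f (L (x + t • w)) := (hf.differentiable (by norm_num)).differentiableAt
    rw [fderiv_comp (x + t • w) hd L.differentiableAt, L.fderiv, ContinuousLinearMap.comp_apply, map_add, map_smul]
  rw [hfun] at h1
  exact h1.unique h2

/-- **THE HESSIAN OF A BLOCK SUM IS BLOCK-DIAGONAL**: for `g = C + Σ_b f_b ∘ π_b` with `f_b ∈ C²`,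
`D²g(x)(w,w) = Σ_b D²f_b(π_b x)(π_b w, π_b w)`. [folklore] -/
theorem fderiv_fderiv_blockSum [Fintype ι] (e : ι × Fin m ≃ Fin n) {f : ι → (Fin m → ℝ) → ℝ}
    (hf : ∀ b, ContDiff ℝ 2 (f b)) (C : ℝ) (x w : Fin n → ℝ) :
    fderiv ℝ (fderiv ℝ (fun y => C + ∑ b, f b (blockProj e b y))) x w w
      = ∑ b, fderiv ℝ (fderiv ℝ (f b)) (blockProj e b x) (blockProj e b w) (blockProj e b w) := by
  set g : (Fin n → ℝ) → ℝ := fun y => C + ∑ b, f b (blockProj e b y) with hg_def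
  have hgb : ∀ b, ContDiff ℝ 2 (fun y => f b (blockProj e b y)) := fun b => (hf b).comp (blockProj e b).contDiff
  have hg : ContDiff ℝ 2 g := contDiff_const.add (ContDiff.sum fun b _ => hgb b)
  have h1 := hasDerivAt_fderiv_line hg x w
  have hfun : (fun t : ℝ => fderiv ℝ g (x + t • w) w)
      = fun t : ℝ => ∑ b, fderiv ℝ (f b ∘ ⇑(blockProj e b)) (x + t • w) w := by
    funext t
    have hdiff : ∀ b ∈ (Finset.univ : Finset ι), DifferentiableAt ℝ (fun y => f b (blockProj e b y)) (x + t • w) :=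
      fun b _ => ((hgb b).differentiable (by norm_num)).differentiableAt
    rw [hg_def, fderiv_const_add, fderiv_fun_sum hdiff, FunLike.coe_sum, Finset.sum_apply]
    rfl
  have h2 : HasDerivAt (fun t : ℝ => ∑ b, fderiv ℝ (f b ∘ ⇑(blockProj e b)) (x + t • w) w)
      (∑ b, fderiv ℝ (fderiv ℝ (f b)) (blockProj e b x) (blockProj e b w) (blockProj e b w)) 0 := by
    have := HasDerivAt.fun_sum (u := (Finset.univ : Finset ι))
      (A := fun b (t : ℝ) => fderiv ℝ (f b ∘ ⇑(blockProj e b)) (x + t • w) w)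
      (A' := fun b => fderiv ℝ (fderiv ℝ (f b)) (blockProj e b x) (blockProj e b w) (blockProj e b w)) (x := 0)
      (fun b _ => by
        have h := hasDerivAt_fderiv_line ((hf b).comp (blockProj e b).contDiff) x w
        rwa [fderiv_fderiv_comp_clm (hf b)] at h)
    simpa using this
  rw [hfun] at h1
  exact h1.unique h2

/-- **`HessianBoundOn` OF A BLOCK SUM**: if each block profile satisfies `HessianBoundOn f_b [-S,S]ᵐ μ_b` and `μ ≤ μ_b`
for all `b`, then `HessianBoundOn (C + Σ_b f_b ∘ π_b) [-S,S]ⁿ μ` — `D²g(x)(w,w) = Σ_b D²f_b(π_b x)(π_b w,π_b w)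
≥ Σ_b μ_b |π_b w|² ≥ μ Σ_b |π_b w|² = μ|w|²`. [folklore] -/
theorem hessianBoundOn_blockSum [Fintype ι] (e : ι × Fin m ≃ Fin n) {f : ι → (Fin m → ℝ) → ℝ}
    (hf : ∀ b, ContDiff ℝ 2 (f b)) (C : ℝ) {S mu : ℝ} {mub : ι → ℝ}
    (hB : ∀ b, HessianBoundOn (f b) (cube m S) (mub b)) (hle : ∀ b, mu ≤ mub b) :
    HessianBoundOn (fun y => C + ∑ b, f b (blockProj e b y)) (cube n S) mu := by
  have hg : ContDiff ℝ 2 (fun y => C + ∑ b, f b (blockProj e b y)) :=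
    contDiff_const.add (ContDiff.sum fun b _ => (hf b).comp (blockProj e b).contDiff)
  rw [hessianBoundOn_iff_fderiv hg]
  intro x hx w
  rw [fderiv_fderiv_blockSum e hf C x w, ← sum_blockProj_dotProduct e w w, Finset.mul_sum]
  refine Finset.sum_le_sum fun b _ => ?_
  have hb := (hessianBoundOn_iff_fderiv (hf b)).1 (hB b) (blockProj e b x) (blockProj_mem_cube e b hx)
    (blockProj e b w)
  refine le_trans ?_ hb
  exact mul_le_mul_of_nonneg_right (hle b) (by simpa using dotProduct_star_self_nonneg (blockProj e b w))

/-- **THE DERIVATIVE OF A BLOCK SUM**: `D(C + Σ_b f_b∘π_b)(x) w = Σ_b Df_b(π_b x)(π_b w)`. [folklore] -/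
theorem fderiv_blockSum [Fintype ι] (e : ι × Fin m ≃ Fin n) {f : ι → (Fin m → ℝ) → ℝ}
    (hf : ∀ b, Differentiable ℝ (f b)) (C : ℝ) (x w : Fin n → ℝ) :
    fderiv ℝ (fun y => C + ∑ b, f b (blockProj e b y)) x w = ∑ b, fderiv ℝ (f b) (blockProj e b x) (blockProj e b w) := by
  have hdiff : ∀ b ∈ (Finset.univ : Finset ι), DifferentiableAt ℝ (fun y => f b (blockProj e b y)) x :=
    fun b _ => ((hf b).comp (blockProj e b).differentiable).differentiableAt
  rw [fderiv_const_add, fderiv_fun_sum hdiff, FunLike.coe_sum, Finset.sum_apply]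
  refine Finset.sum_congr rfl fun b _ => ?_
  rw [show (fun y => f b (blockProj e b y)) = f b ∘ ⇑(blockProj e b) from rfl,
    fderiv_comp x (hf b _) (blockProj e b).differentiableAt, (blockProj e b).fderiv, ContinuousLinearMap.comp_apply]

/-- A weighted Cauchy–Schwarz step: `t_b² ≤ G_b²·n_b` (`n_b ≥ 0`) for all `b` ⟹ `(Σ_b t_b)² ≤ (Σ_b G_b²)·(Σ_b n_b)`.
[folklore] -/
theorem sq_sum_le_sum_sq_mul_sum {κ : Type*} (T : Finset κ) {t G nb : κ → ℝ} (hn : ∀ b ∈ T, 0 ≤ nb b)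
    (h : ∀ b ∈ T, t b ^ 2 ≤ G b ^ 2 * nb b) : (∑ b ∈ T, t b) ^ 2 ≤ (∑ b ∈ T, G b ^ 2) * ∑ b ∈ T, nb b := by
  have h1 : ∀ b ∈ T, |t b| ≤ |G b| * Real.sqrt (nb b) := fun b hb => by
    have h' := Real.sqrt_le_sqrt (h b hb)
    rwa [Real.sqrt_sq_eq_abs, Real.sqrt_mul (sq_nonneg _), Real.sqrt_sq_eq_abs] at h'
  have h2 : |∑ b ∈ T, t b| ≤ ∑ b ∈ T, |G b| * Real.sqrt (nb b) :=
    (Finset.abs_sum_le_sum_abs _ _).trans (Finset.sum_le_sum h1)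
  have h3 := Finset.sum_mul_sq_le_sq_mul_sq T (fun b => |G b|) (fun b => Real.sqrt (nb b))
  have h4 : ∑ b ∈ T, |G b| ^ 2 = ∑ b ∈ T, G b ^ 2 := Finset.sum_congr rfl fun b _ => sq_abs _
  have h5 : ∑ b ∈ T, Real.sqrt (nb b) ^ 2 = ∑ b ∈ T, nb b := Finset.sum_congr rfl fun b hb => Real.sq_sqrt (hn b hb)
  calc (∑ b ∈ T, t b) ^ 2 = |∑ b ∈ T, t b| ^ 2 := (sq_abs _).symm
    _ ≤ (∑ b ∈ T, |G b| * Real.sqrt (nb b)) ^ 2 := pow_le_pow_left₀ (abs_nonneg _) h2 2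
    _ ≤ (∑ b ∈ T, |G b| ^ 2) * ∑ b ∈ T, Real.sqrt (nb b) ^ 2 := h3
    _ = (∑ b ∈ T, G b ^ 2) * ∑ b ∈ T, nb b := by rw [h4, h5]

/-- **THE GRADIENT OF A BLOCK SUM**: block Lipschitz bounds `(Df_b(π_b x) w)² ≤ G_b²|w|²` give
`|∇(C + Σ_b f_b∘π_b)(x)|² ≤ Σ_b G_b²` (the blocks are orthogonal: `Σ_b |π_b w|² = |w|²`). [folklore] -/
theorem coordGradient_blockSum_sq_le [Fintype ι] (e : ι × Fin m ≃ Fin n) {f : ι → (Fin m → ℝ) → ℝ}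
    (hf : ∀ b, Differentiable ℝ (f b)) (C : ℝ) {G : ι → ℝ} {x : Fin n → ℝ}
    (hG : ∀ b w, (fderiv ℝ (f b) (blockProj e b x) w) ^ 2 ≤ G b ^ 2 * (w ⬝ᵥ w)) :
    coordGradient (fun y => C + ∑ b, f b (blockProj e b y)) x
        ⬝ᵥ coordGradient (fun y => C + ∑ b, f b (blockProj e b y)) x ≤ ∑ b, G b ^ 2 := by
  have hS : 0 ≤ ∑ b, G b ^ 2 := Finset.sum_nonneg fun b _ => sq_nonneg _
  have key : ∀ w, (fderiv ℝ (fun y => C + ∑ b, f b (blockProj e b y)) x w) ^ 2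
      ≤ Real.sqrt (∑ b, G b ^ 2) ^ 2 * (w ⬝ᵥ w) := fun w => by
    rw [Real.sq_sqrt hS, fderiv_blockSum e hf C x w, ← sum_blockProj_dotProduct e w w]
    exact sq_sum_le_sum_sq_mul_sum _ (fun b _ => by simpa using dotProduct_star_self_nonneg (blockProj e b w))
      (fun b _ => hG b _)
  have h := coordGradient_sq_le_of_sq_fderiv_le key
  rwa [Real.sq_sqrt hS] at h

end Blocks

/-! ## §2  Plaquette-disjoint link sets -/

variable {P : Params} {j : ℕ}

/-- **PLAQUETTE-DISJOINT LINK SET**: no two links of `s` are letters of one plaquette (no link of `s` is a staple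
bond of another). [folklore] -/
def PlaqDisjoint (s : Finset (PBond P j)) : Prop := ∀ b ∈ s, ∀ b', IsStaple b b' → b' ∉ s

/-- The empty link set is plaquette-disjoint. [folklore] -/
theorem plaqDisjoint_empty : PlaqDisjoint (∅ : Finset (PBond P j)) := fun _ h => absurd h (Finset.notMem_empty _)

/-- A one-link set is plaquette-disjoint (a staple bond of `b` is `≠ b`): the one-link leaves of the lineage are the
case `s = {b}` of this one. [folklore] -/
theorem plaqDisjoint_singleton (b : PBond P j) : PlaqDisjoint ({b} : Finset (PBond P j)) := by
  intro b₁ hb₁ b' hst hb'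
  rw [Finset.mem_singleton] at hb₁ hb'
  exact hst.1 (hb'.trans hb₁.symm)

/-- Subsets of plaquette-disjoint sets are plaquette-disjoint. [folklore] -/
theorem PlaqDisjoint.subset {s t : Finset (PBond P j)} (hs : PlaqDisjoint s) (hts : t ⊆ s) : PlaqDisjoint t :=
  fun b hb b' hst hb' => hs b (hts hb) b' hst (hts hb')

/-- The plaquette at `x₀` in the coordinate plane `(0,1)` (`d ≥ 2`). [folklore] -/
def cornerPlaq (h2 : 2 ≤ P.d) (x₀ : Site P j) : Plaq P j :=
  ⟨x₀, ⟨0, by omega⟩, ⟨1, by omega⟩, by simp [Fin.lt_def]⟩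

/-- The two bonds leaving `x₀` in directions `0` and `1` are letters of `cornerPlaq`: the second is a staple bond of
the first. [folklore] -/
theorem isStaple_corner (h2 : 2 ≤ P.d) (x₀ : Site P j) :
    IsStaple (⟨x₀, ⟨0, by omega⟩⟩ : PBond P j) ⟨x₀, ⟨1, by omega⟩⟩ := by
  refine ⟨?_, cornerPlaq h2 x₀, Or.inl rfl, Or.inr (Or.inr (Or.inr rfl))⟩
  intro h
  have := congrArg (fun b : PBond P j => (b.dir : ℕ)) h
  simp at this

/-- **CONSISTENCY WITH THE NO-GO** (`T4WilsonGaugeFlatDirection`): for `d ≥ 2` a plaquette-disjoint link set contains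
no star, so the flat-direction verdict `μ ≤ 0` does not apply to it. [folklore] -/
theorem not_containsStar_of_plaqDisjoint (h2 : 2 ≤ P.d) {s : Finset (PBond P j)} (hs : PlaqDisjoint s)
    (x₀ : Site P j) : ¬ ContainsStar s x₀ := by
  intro hstar
  have h0 : (⟨x₀, ⟨0, by omega⟩⟩ : PBond P j) ∈ s := hstar _ (Or.inl rfl)
  have h1 : (⟨x₀, ⟨1, by omega⟩⟩ : PBond P j) ∈ s := hstar _ (Or.inl rfl)
  exact hs _ h0 _ (isStaple_corner h2 x₀) h1

/-! ## §3  Locality of the Wilson datum -/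

variable [DecidableEq (PBond P j)]

/-- An exterior agreeing with `u₀` on the staple bonds of `b` has staple deviation `0` there
(`T4WilsonStapleDeviation.stapleDist_le_of_staple` with `δ = 0`). [folklore] -/
theorem stapleDist_eq_zero_of_agree {b : PBond P j} {u₀ u : GaugeField P j SU2}
    (h : ∀ b', IsStaple b b' → u b' = u₀ b') : stapleDist b u₀ u = 0 := by
  have hδ : ∀ b', IsStaple b b' → ‖su2Quat (u b') - su2Quat (u₀ b')‖ ≤ 0 := fun b' hb' => by
    rw [h b' hb', sub_self, norm_zero]
  have hle := stapleDist_le_of_staple (le_refl (0 : ℝ)) hδ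
  rw [mul_zero, mul_zero] at hle
  exact le_antisymm hle (stapleDist_nonneg b u₀ u)

/-- **THE WILSON DATUM THROUGH `b` SEES ONLY THE STAPLE BONDS OF `b`**: two fields agreeing there have the same datum
(`T4WilsonStapleDeviation.norm_wilsonDatum_sub_le_stapleDist`). [folklore] -/
theorem wilsonDatum_eq_of_agree (c w : ℝ) {b : PBond P j} {u₀ u : GaugeField P j SU2}
    (h : ∀ b', IsStaple b b' → u b' = u₀ b') : wilsonDatum c w u b = wilsonDatum c w u₀ b := by
  have hn := norm_wilsonDatum_sub_le_stapleDist c w b u₀ u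
  rw [stapleDist_eq_zero_of_agree h, mul_zero] at hn
  exact sub_eq_zero.1 (norm_le_zero_iff.1 hn)

/-! ## §4  The multi-affine expansion of the Wilson exponent on a plaquette-disjoint fibre -/

variable {s : Finset (PBond P j)} {u : GaugeField P j SU2}

/-- The fibre point `y` RESET to the exterior `u` outside `t ⊆ s` (the induction variable of the expansion).
[folklore] -/
def resetOff (u : GaugeField P j SU2) (y : ↥s → SU2) (t : Finset ↥s) : ↥s → SU2 :=
  fun b => if b ∈ t then y b else u b

/-- Reset everywhere: the field is the exterior itself. [folklore] -/
theorem updateFinset_resetOff_empty (y : ↥s → SU2) : updateFinset u s (resetOff u y ∅) = u := by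
  funext i
  unfold updateFinset resetOff
  by_cases hi : i ∈ s
  · rw [dif_pos hi, if_neg (Finset.notMem_empty _)]
  · rw [dif_neg hi]

/-- Reset nowhere: the field is the fibre point. [folklore] -/
theorem updateFinset_resetOff_univ (y : ↥s → SU2) :
    updateFinset u s (resetOff u y Finset.univ) = updateFinset u s y := by
  unfold resetOff
  simp only [Finset.mem_univ, if_true]

/-- Un-resetting one more link is a one-link update. [folklore] -/
theorem updateFinset_resetOff_insert (y : ↥s → SU2) (t : Finset ↥s) (b : ↥s) :
    updateFinset u s (resetOff u y (insert b t)) = Function.update (updateFinset u s (resetOff u y t)) b (y b) := by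
  funext i
  by_cases hi : i = (b : PBond P j)
  · subst hi
    rw [Function.update_self]
    unfold updateFinset resetOff
    rw [dif_pos b.2]
    simp
  · rw [Function.update_of_ne hi]
    unfold updateFinset resetOff
    by_cases his : i ∈ s
    · rw [dif_pos his, dif_pos his]
      have hne : (⟨i, his⟩ : ↥s) ≠ b := fun h => hi (congrArg Subtype.val h)
      simp [Finset.mem_insert, hne]
    · rw [dif_neg his, dif_neg his]

/-- A link not yet un-reset carries the exterior's value. [folklore] -/
theorem updateFinset_resetOff_apply_self (y : ↥s → SU2) {t : Finset ↥s} {b : ↥s} (hb : b ∉ t) :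
    updateFinset u s (resetOff u y t) b = u b := by
  unfold updateFinset resetOff
  rw [dif_pos b.2]
  simp [hb]

/-- **THE MULTI-AFFINE EXPANSION, induction form**: on a plaquette-disjoint `s`, for every `t ⊆ s`,
`c·A_w(u ←ₛ resetOff u y t) = c·A_w(u) + Σ_{b ∈ t} Re((q(y_b) − q(u b)) · wilsonDatum c w u b)` — each step is the
one-link affinity `T4WilsonLinkAffine.linkAffine_wilsonAction` at the partially reset field, whose datum through `b`
equals the exterior's because the staple bonds of `b` are not in `s` (`wilsonDatum_eq_of_agree`). [folklore] -/
theorem mul_wilsonAction_resetOff (hdis : PlaqDisjoint s) (c w : ℝ) (y : ↥s → SU2) (t : Finset ↥s) :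
    c * wilsonAction w (updateFinset u s (resetOff u y t))
      = c * wilsonAction w u + ∑ b ∈ t, ((su2Quat (y b) - su2Quat (u b)) * wilsonDatum c w u b).re := by
  induction t using Finset.induction_on with
  | empty => rw [updateFinset_resetOff_empty, Finset.sum_empty, add_zero]
  | insert b t hb ih =>
    rw [updateFinset_resetOff_insert y t b, Finset.sum_insert hb]
    have haff := linkAffine_wilsonAction c w (updateFinset u s (resetOff u y t)) (b : PBond P j)
    have h1 := haff (y b)
    have h0 := haff (updateFinset u s (resetOff u y t) b)
    dsimp only at h1 h0
    rw [Function.update_eq_self, updateFinset_resetOff_apply_self y hb] at h0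
    have hdat : wilsonDatum c w (updateFinset u s (resetOff u y t)) b = wilsonDatum c w u b := by
      refine wilsonDatum_eq_of_agree c w fun b' hst => ?_
      have hb' : (b' : PBond P j) ∉ s := hdis b b.2 b' hst
      unfold updateFinset
      rw [dif_neg hb']
    rw [hdat] at h1 h0
    rw [h1, sub_mul, Quaternion.re_sub]
    linarith [ih, h0]

/-- **THE MULTI-AFFINE EXPANSION** of the Wilson exponent on a plaquette-disjoint fibre about ANY exterior `u`:
`c·A_w(u ←ₛ y) = c·A_w(u) + Σ_{b ∈ s} Re((q(y_b) − q(u b)) · wilsonDatum c w u b)`. [folklore] -/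
theorem mul_wilsonAction_updateFinset (hdis : PlaqDisjoint s) (c w : ℝ) (y : ↥s → SU2) :
    c * wilsonAction w (updateFinset u s y)
      = c * wilsonAction w u + ∑ b : ↥s, ((su2Quat (y b) - su2Quat (u b)) * wilsonDatum c w u b).re := by
  rw [← updateFinset_resetOff_univ y]
  exact mul_wilsonAction_resetOff hdis c w y Finset.univ

/-! ## §5  The `C²` representative on `ℝⁿ`: agreement, window Hessian bound, gradient gap -/

variable {n : ℕ} {u₀ : GaugeField P j SU2}

/-- THE ROTATED DATUM of the link `b`: `c_b = wilsonDatum c w u b · su2Quat(u₀ b)` (exterior `u`, chart centre `u₀`;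
the one-link leaves' `a · su2Quat(u₀ b)`). [folklore] -/
def blockDatum (u₀ u : GaugeField P j SU2) (c w : ℝ) (b : PBond P j) : ℍ := wilsonDatum c w u b * su2Quat (u₀ b)

/-- THE CONSTANT of the representative: `−c·A_w(u) + Σ_{b ∈ s} Re(q(u b) · wilsonDatum c w u b)`. [folklore] -/
def disjConst (s : Finset (PBond P j)) (u : GaugeField P j SU2) (c w : ℝ) : ℝ :=
  -(c * wilsonAction w u) + ∑ b : ↥s, (su2Quat (u b) * wilsonDatum c w u b).re

/-- **THE `C²` REPRESENTATIVE** of `x ↦ −c·A_w(u ←ₛ φ_{u₀,e}(x))` on a plaquette-disjoint fibre: the constant plus the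
SUM over the links of the one-link gnomonic profiles `F_{Re c_b, Im c_b}` in the link's own coordinates `π_b x`.
[folklore] -/
def disjRep (s : Finset (PBond P j)) (e : ↥s × Fin 3 ≃ Fin n) (u₀ u : GaugeField P j SU2) (c w : ℝ) :
    (Fin n → ℝ) → ℝ :=
  fun x => disjConst s u c w
    + ∑ b : ↥s, gnoProfile (blockDatum u₀ u c w b).re (imVec (blockDatum u₀ u c w b)) (blockProj e b x)

omit [DecidableEq (PBond P j)] in
/-- The fibre chart at the link `b` is the gnomonic chart about `u₀ b` in the block coordinates `π_b x`. [folklore] -/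
theorem gnoFibreChart_eq_gnoChart_blockProj (e : ↥s × Fin 3 ≃ Fin n) (x : Fin n → ℝ) (b : ↥s) :
    gnoFibreChart s u₀ e x b = gnoChart (u₀ b) (blockProj e b x) := rfl

/-- The block term of the expansion along the chart: `Re((q(u₀ b·P(1,π_b x)) − q(u b)) · a_b) =
−F_{Re c_b, Im c_b}(π_b x) − Re(q(u b) · a_b)` (`T4GnomonicWilsonHessian.re_su2Quat_gnoChart_mul`). [folklore] -/
theorem re_chart_term (e : ↥s × Fin 3 ≃ Fin n) (c w : ℝ) (x : Fin n → ℝ) (b : ↥s) :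
    ((su2Quat (gnoFibreChart s u₀ e x b) - su2Quat (u b)) * wilsonDatum c w u b).re
      = -gnoProfile (blockDatum u₀ u c w b).re (imVec (blockDatum u₀ u c w b)) (blockProj e b x)
        - (su2Quat (u b) * wilsonDatum c w u b).re := by
  rw [sub_mul, Quaternion.re_sub, gnoFibreChart_eq_gnoChart_blockProj, re_su2Quat_gnoChart_mul, blockDatum]

/-- **(R1) AGREEMENT ON ALL OF `ℝⁿ`** (the plug's `agree₀` for `u = u₀` and `agree₁` for the actual exterior `u`,
even without the restriction to the cube): `disjRep s e u₀ u c w x = −c·A_w(u ←ₛ φ_{u₀,e}(x))`. [folklore] -/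
theorem disjRep_eq (hdis : PlaqDisjoint s) (e : ↥s × Fin 3 ≃ Fin n) (c w : ℝ) (x : Fin n → ℝ) :
    disjRep s e u₀ u c w x = -(c * wilsonAction w (updateFinset u s (gnoFibreChart s u₀ e x))) := by
  rw [mul_wilsonAction_updateFinset hdis, Finset.sum_congr rfl fun b _ => re_chart_term e c w x b]
  simp only [disjRep, disjConst, Finset.sum_sub_distrib, Finset.sum_neg_distrib]
  ring

/-- **(R2)** the representative is smooth (the plug's `hg₀`/`hg₁`). [folklore] -/
theorem contDiff_disjRep (e : ↥s × Fin 3 ≃ Fin n) (c w : ℝ) {k : WithTop ℕ∞} :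
    ContDiff ℝ k (disjRep s e u₀ u c w) :=
  contDiff_const.add (ContDiff.sum fun b _ => (contDiff_gnoProfile _ _).comp (blockProj e b).contDiff)

/-- **(R3) THE WINDOW HESSIAN BOUND FROM PER-LINK DATA BOUNDS**: aligned parts `Re c_b ≥ A_b ≥ 0`, transverse parts
`|a_b|² − (Re c_b)² ≤ b₀_b²`, `0 ≤ ρ`, `2ρ² ≤ 1`, the PER-LINK window `3·S'² ≤ ρ²`, and `μ ≤ gnoMu(A_b, b₀_b, ρ)` for
every link ⟹ `HessianBoundOn (disjRep …) [-S',S']ⁿ μ` (`hessianBoundOn_blockSum` over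
`T4GnomonicWilsonHessian.hessianBoundOn_gnoProfile_cube` in dimension `3`). [folklore] -/
theorem hessianBoundOn_disjRep_of_blocks (e : ↥s × Fin 3 ≃ Fin n) (c w : ℝ) {S' mu ρ : ℝ} {A b₀ : ↥s → ℝ}
    (hA : ∀ b, 0 ≤ A b) (hAle : ∀ b, A b ≤ (blockDatum u₀ u c w b).re) (hb₀ : ∀ b, 0 ≤ b₀ b)
    (hB : ∀ b : ↥s, ‖wilsonDatum c w u b‖ ^ 2 - (blockDatum u₀ u c w b).re ^ 2 ≤ b₀ b ^ 2)
    (hρ : 0 ≤ ρ) (hρ2 : 2 * ρ ^ 2 ≤ 1) (h3S : 3 * S' ^ 2 ≤ ρ ^ 2) (hmu : ∀ b, mu ≤ gnoMu (A b) (b₀ b) ρ) :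
    HessianBoundOn (disjRep s e u₀ u c w) (cube n S') mu := by
  refine hessianBoundOn_blockSum e (fun b => contDiff_gnoProfile _ _) _ (fun b => ?_) hmu
  have hB' : imVec (blockDatum u₀ u c w b) ⬝ᵥ imVec (blockDatum u₀ u c w b) ≤ b₀ b ^ 2 := by
    rw [imVec_dotProduct_self, blockDatum, norm_mul, norm_su2Quat, mul_one]
    exact hB b
  have h3 : ((3 : ℕ) : ℝ) * S' ^ 2 ≤ ρ ^ 2 := by simpa using h3S
  exact T4GnomonicWilsonHessian.HessianBoundOn.of_le
    (hessianBoundOn_gnoProfile_cube ((hA b).trans (hAle b)) (hb₀ b) hB' hρ hρ2 h3) (gnoMu_mono_left (hAle b) hρ2)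

/-- **(R3′) THE WILSON SMALL-FIELD NUMBERS, PER LINK** (exterior `u`, chart centre `u₀`, Gibbs sign `c = −β`):
`0 ≤ β·w`, `0 ≤ ε ≤ 1`, the small field `reTr ≥ 1 − ε` of the HYBRID plaquettes `(u ←_b u₀ b)(∂p)` through every link
`b ∈ s`, `0 ≤ ρ`, `2ρ² ≤ 1` and the PER-LINK window `3·S'² ≤ ρ²` ⟹ `HessianBoundOn (disjRep s e u₀ u (−β) w) [-S',S']ⁿ
μ` with the ONE-LINK modulus `μ = gnoMu(β·w·2(d−1)(1−ε), β·w·2(d−1)√(2ε), ρ)` (`T4WilsonDatumBounds.wilson_aligned_ge`,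
`wilson_transverse_le`, `letterCount_cast` per link). [folklore] -/
theorem hessianBoundOn_disjRep {β w ε : ℝ} (hβw : 0 ≤ β * w) (hε0 : 0 ≤ ε) (hε1 : ε ≤ 1) (e : ↥s × Fin 3 ≃ Fin n)
    (hsf : ∀ b ∈ s, ∀ p, IsLetter b p → 1 - ε ≤ reTr (GaugeField.plaqHol (Function.update u b (u₀ b)) p))
    {S' ρ : ℝ} (hρ : 0 ≤ ρ) (hρ2 : 2 * ρ ^ 2 ≤ 1) (h3S : 3 * S' ^ 2 ≤ ρ ^ 2) :
    HessianBoundOn (disjRep s e u₀ u (-β) w) (cube n S')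
      (gnoMu (β * w * (2 * ((P.d : ℝ) - 1)) * (1 - ε)) (β * w * (2 * ((P.d : ℝ) - 1)) * Real.sqrt (2 * ε)) ρ) := by
  have hd1 : (1 : ℝ) ≤ P.d := Nat.one_le_cast.2 P.hd
  have hN : 0 ≤ β * w * (2 * ((P.d : ℝ) - 1)) := mul_nonneg hβw (by linarith)
  refine hessianBoundOn_disjRep_of_blocks e (-β) w
    (A := fun _ => β * w * (2 * ((P.d : ℝ) - 1)) * (1 - ε))
    (b₀ := fun _ => β * w * (2 * ((P.d : ℝ) - 1)) * Real.sqrt (2 * ε))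
    (fun _ => mul_nonneg hN (by linarith)) (fun b => ?_) (fun _ => mul_nonneg hN (Real.sqrt_nonneg _)) (fun b => ?_)
    hρ hρ2 h3S (fun _ => le_rfl)
  · have h := wilson_aligned_ge hβw (hsf b b.2)
    rw [letterCount_cast] at h
    simpa only [blockDatum, mul_assoc] using h
  · have h := wilson_transverse_le hβw hε0 hε1 (hsf b b.2)
    rw [letterCount_cast] at h
    simpa only [blockDatum, mul_assoc] using h

/-- **(R3″) THE REFERENCE EXTERIOR** `u = u₀` (the plug's `hB₀`): the plain small field `reTr(u₀(∂p)) ≥ 1 − ε` on the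
plaquettes through the links of `s` gives the same modulus. [folklore] -/
theorem hessianBoundOn_disjRep_self {β w ε : ℝ} (hβw : 0 ≤ β * w) (hε0 : 0 ≤ ε) (hε1 : ε ≤ 1) (e : ↥s × Fin 3 ≃ Fin n)
    (hsf : ∀ b ∈ s, ∀ p, IsLetter b p → 1 - ε ≤ reTr (GaugeField.plaqHol u₀ p))
    {S' ρ : ℝ} (hρ : 0 ≤ ρ) (hρ2 : 2 * ρ ^ 2 ≤ 1) (h3S : 3 * S' ^ 2 ≤ ρ ^ 2) :
    HessianBoundOn (disjRep s e u₀ u₀ (-β) w) (cube n S')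
      (gnoMu (β * w * (2 * ((P.d : ℝ) - 1)) * (1 - ε)) (β * w * (2 * ((P.d : ℝ) - 1)) * Real.sqrt (2 * ε)) ρ) :=
  hessianBoundOn_disjRep hβw hε0 hε1 e (fun b hb p hp => by rw [Function.update_eq_self]; exact hsf b hb p hp)
    hρ hρ2 h3S


/-- The rotated data of the two exteriors differ by the rotated datum difference. [folklore] -/
theorem blockDatum_sub (c w : ℝ) (b : PBond P j) :
    blockDatum u₀ u c w b - blockDatum u₀ u₀ c w b = (wilsonDatum c w u b - wilsonDatum c w u₀ b) * su2Quat (u₀ b) := by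
  rw [blockDatum, blockDatum, sub_mul]

/-- **(R4) THE DIFFERENCE OF THE TWO REPRESENTATIVES** (actual exterior `u` minus reference `u₀`, same chart centre)
is again a constant plus a block sum of profiles, with the DIFFERENCE data (`gnoProfile_sub`). [folklore] -/
theorem disjRep_sub (e : ↥s × Fin 3 ≃ Fin n) (c w : ℝ) (x : Fin n → ℝ) :
    disjRep s e u₀ u c w x - disjRep s e u₀ u₀ c w x = (disjConst s u c w - disjConst s u₀ c w)
      + ∑ b : ↥s, gnoProfile (blockDatum u₀ u c w b - blockDatum u₀ u₀ c w b).re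
          (imVec (blockDatum u₀ u c w b - blockDatum u₀ u₀ c w b)) (blockProj e b x) := by
  rw [disjRep, disjRep, add_sub_add_comm, ← Finset.sum_sub_distrib]
  refine congrArg _ (Finset.sum_congr rfl fun b _ => ?_)
  rw [Quaternion.re_sub, imVec_sub, ← gnoProfile_sub]

/-- **(R4′) THE GRADIENT GAP** on the per-link balls `|π_b x|² ≤ ρ²`:
`|∇(g₁ − g₀)(x)|² ≤ Σ_{b ∈ s} (|a_b(u) − a_b(u₀)|·(1 + ρ + ρ²))²` (`coordGradient_blockSum_sq_le` over the one-link
estimate `T4GnomonicWilsonHessian.sq_fderiv_gnoProfile_le`). [folklore] -/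
theorem coordGradient_disjRep_sub_sq_le (e : ↥s × Fin 3 ≃ Fin n) (c w : ℝ) {ρ : ℝ} (hρ : 0 ≤ ρ) {x : Fin n → ℝ}
    (hx : ∀ b : ↥s, blockProj e b x ⬝ᵥ blockProj e b x ≤ ρ ^ 2) :
    coordGradient (fun x => disjRep s e u₀ u c w x - disjRep s e u₀ u₀ c w x) x
        ⬝ᵥ coordGradient (fun x => disjRep s e u₀ u c w x - disjRep s e u₀ u₀ c w x) x
      ≤ ∑ b : ↥s, (‖wilsonDatum c w u b - wilsonDatum c w u₀ b‖ * (1 + ρ + ρ ^ 2)) ^ 2 := by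
  have hfun : (fun x => disjRep s e u₀ u c w x - disjRep s e u₀ u₀ c w x)
      = fun x => (disjConst s u c w - disjConst s u₀ c w)
        + ∑ b : ↥s, gnoProfile (blockDatum u₀ u c w b - blockDatum u₀ u₀ c w b).re
            (imVec (blockDatum u₀ u c w b - blockDatum u₀ u₀ c w b)) (blockProj e b x) :=
    funext (disjRep_sub e c w)
  rw [hfun]
  refine coordGradient_blockSum_sq_le e
    (fun b => (contDiff_gnoProfile _ _ : ContDiff ℝ 1 _).differentiable (by norm_num)) _ fun b w' => ?_
  set Δ : ℍ := blockDatum u₀ u c w b - blockDatum u₀ u₀ c w b with hΔ_def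
  have hnorm : ‖Δ‖ = ‖wilsonDatum c w u b - wilsonDatum c w u₀ b‖ := by
    rw [hΔ_def, blockDatum_sub, norm_mul, norm_su2Quat, mul_one]
  have h2 : (0 : ℝ) ≤ imVec Δ ⬝ᵥ imVec Δ := by simpa using dotProduct_star_self_nonneg (imVec Δ)
  have hB : imVec Δ ⬝ᵥ imVec Δ ≤ ‖Δ‖ ^ 2 := by rw [imVec_dotProduct_self]; linarith [sq_nonneg Δ.re]
  have hA : |Δ.re| ≤ ‖Δ‖ := by
    refine abs_le_of_sq_le_sq ?_ (norm_nonneg _)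
    linarith [imVec_dotProduct_self Δ]
  have hw' : 0 ≤ w' ⬝ᵥ w' := by simpa using dotProduct_star_self_nonneg w'
  refine (sq_fderiv_gnoProfile_le (norm_nonneg Δ) hB hρ (hx b) w').trans (mul_le_mul_of_nonneg_right ?_ hw')
  rw [← hnorm]
  have h1 : ‖Δ‖ * (1 + ρ ^ 2) + |Δ.re| * ρ ≤ ‖Δ‖ * (1 + ρ + ρ ^ 2) := by
    nlinarith [mul_le_mul_of_nonneg_right hA hρ]
  exact pow_le_pow_left₀ (by positivity) h1 2

/-- **(R4″) THE GRADIENT GAP IN STAPLE CURRENCY**: `|∇(g₁ − g₀)(x)|² ≤ (|c·w|·(1 + ρ + ρ²)·Σ_{b ∈ s} stapleDist b u₀ u)²`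
(`T4WilsonStapleDeviation.norm_wilsonDatum_sub_le_stapleDist` per link; `Σ G_b² ≤ (Σ G_b)²`). [folklore] -/
theorem coordGradient_disjRep_sub_sq_le_stapleDist (e : ↥s × Fin 3 ≃ Fin n) (c w : ℝ) {ρ : ℝ} (hρ : 0 ≤ ρ)
    {x : Fin n → ℝ} (hx : ∀ b : ↥s, blockProj e b x ⬝ᵥ blockProj e b x ≤ ρ ^ 2) :
    coordGradient (fun x => disjRep s e u₀ u c w x - disjRep s e u₀ u₀ c w x) x
        ⬝ᵥ coordGradient (fun x => disjRep s e u₀ u c w x - disjRep s e u₀ u₀ c w x) x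
      ≤ (|c * w| * (1 + ρ + ρ ^ 2) * ∑ b : ↥s, stapleDist b u₀ u) ^ 2 := by
  refine (coordGradient_disjRep_sub_sq_le e c w hρ hx).trans ?_
  have hk : 0 ≤ 1 + ρ + ρ ^ 2 := by positivity
  have hG : ∀ b : ↥s, ‖wilsonDatum c w u b - wilsonDatum c w u₀ b‖ * (1 + ρ + ρ ^ 2)
      ≤ |c * w| * (1 + ρ + ρ ^ 2) * stapleDist b u₀ u := fun b => by
    have h := mul_le_mul_of_nonneg_right (norm_wilsonDatum_sub_le_stapleDist c w b u₀ u) hk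
    linarith [h]
  have h0 : ∀ b : ↥s, 0 ≤ |c * w| * (1 + ρ + ρ ^ 2) * stapleDist b u₀ u :=
    fun b => mul_nonneg (mul_nonneg (abs_nonneg _) hk) (stapleDist_nonneg _ _ _)
  calc ∑ b : ↥s, (‖wilsonDatum c w u b - wilsonDatum c w u₀ b‖ * (1 + ρ + ρ ^ 2)) ^ 2
      ≤ ∑ b : ↥s, (|c * w| * (1 + ρ + ρ ^ 2) * stapleDist b u₀ u) ^ 2 :=
        Finset.sum_le_sum fun b _ => pow_le_pow_left₀ (by positivity) (hG b) 2
    _ ≤ (∑ b : ↥s, |c * w| * (1 + ρ + ρ ^ 2) * stapleDist b u₀ u) ^ 2 :=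
        Finset.sum_sq_le_sq_sum_of_nonneg fun b _ => h0 b
    _ = (|c * w| * (1 + ρ + ρ ^ 2) * ∑ b : ↥s, stapleDist b u₀ u) ^ 2 := by rw [← Finset.mul_sum]

/-! ## §6  THE PLUG on plaquette-disjoint fibres with the action binders DISCHARGED -/

omit [DecidableEq (PBond P j)] in
/-- A block of a point of `[-S,S]ⁿ`, `S ≤ S'`, lies in the ball `|π_b x|² ≤ 3S'²`. [folklore] -/
theorem blockProj_dotProduct_self_le (e : ↥s × Fin 3 ≃ Fin n) {S S' : ℝ} (hSS' : S ≤ S')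
    {x : Fin n → ℝ} (hx : x ∈ cube n S) (b : ↥s) : blockProj e b x ⬝ᵥ blockProj e b x ≤ 3 * S' ^ 2 := by
  have h := dotProduct_self_le_of_mem_cube (blockProj_mem_cube e b (cube_subset_cube hSS' hx))
  simpa using h

/-- **THE DISJOINT-FIBRE WILSON COROLLARY, datum currency.**  `T4CubeConvexExtension.mem_respDom_of_gnoChart_local`
for `h = fun U => −β * wilsonAction w U` through a PLAQUETTE-DISJOINT fibre `s` with the representatives
`g₀ = disjRep s e u₀ u₀ (−β) w`, `g₁ = disjRep s e u₀ u (−β) w` and every action binder reduced to scalars: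
`0 ≤ β`, `0 ≤ w`, `0 ≤ ε ≤ 1/8`, `reTr ≥ 1 − ε` on the plaquettes through the links of `s` for `u₀` and for the
hybrids `u ←_b u₀ b`, `0 ≤ ρ ≤ 1/4`, the PER-LINK window `3·S'² ≤ ρ²` (NOT `n·S'²`), and the budget
`β·w·(1+ρ+ρ²)·Σ_{b ∈ s} stapleDist b u₀ u ≤ bH·dev u`; modulus `gnoKappa S' + 7/25·(β·w·2(d−1))` as for one link.
The measurability / integrability / `hK` / insert binders are the plug's, verbatim. [folklore] -/
theorem mem_respDom_of_wilson_disjoint_datum {ι : Type*} (hdis : PlaqDisjoint s) (e : ↥s × Fin 3 ≃ Fin n) {S : ℝ}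
    (hS : 0 < S) {S' : ℝ} (hSS' : S < S') (hS'1 : S' ≤ 1) {β w : ℝ} (hβ : 0 ≤ β) (hw : 0 ≤ w)
    (hhm : Measurable fun U : GaugeField P j SU2 => -β * wilsonAction w U) {C : ℝ}
    (hC : ∀ U, windowDensity s u₀ S U * Real.exp (-β * wilsonAction w U) ≤ C) {K : ℝ}
    (hK : ∀ y : ↥s → SU2,
      |(-β * wilsonAction w (updateFinset u₀ s y)) - (-β * wilsonAction w (updateFinset u s y))| ≤ K)
    {dev : GaugeField P j SU2 → ℝ} (hdev : 0 ≤ dev u) {ε : ℝ} (hε0 : 0 ≤ ε) (hε8 : ε ≤ 1 / 8)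
    (hsf₀ : ∀ b ∈ s, ∀ p, IsLetter b p → 1 - ε ≤ reTr (GaugeField.plaqHol u₀ p))
    (hsf₁ : ∀ b ∈ s, ∀ p, IsLetter b p → 1 - ε ≤ reTr (GaugeField.plaqHol (Function.update u b (u₀ b)) p))
    {ρ : ℝ} (hρ : 0 ≤ ρ) (hρ4 : ρ ≤ 1 / 4) (h3S : 3 * S' ^ 2 ≤ ρ ^ 2) {bH : ℝ}
    (hgapD : β * w * (1 + ρ + ρ ^ 2) * (∑ b : ↥s, stapleDist b u₀ u) ≤ bH * dev u)
    {B : (↥s → SU2) → ι → ℝ} {T : Finset ι} (hBm : ∀ i ∈ T, Measurable fun y => B y i) {L : ℝ}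
    (hBg : ∀ i ∈ T, ∃ g : (Fin n → ℝ) → ℝ, ContDiff ℝ 1 g ∧
      (∀ x ∈ cube n S, g x = B (gnoFibreChart s u₀ e x) i) ∧
      ∀ x ∈ cube n S, coordGradient g x ⬝ᵥ coordGradient g x ≤ L ^ 2) :
    u ∈ respDom s (windowDensity s u₀ S) (fun U => -β * wilsonAction w U) u₀ B T dev
      (bH / Real.sqrt (gnoKappa S' + 7 / 25 * (β * w * (2 * ((P.d : ℝ) - 1)))))
      (L / Real.sqrt (gnoKappa S' + 7 / 25 * (β * w * (2 * ((P.d : ℝ) - 1))))) := by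
  have hβw : 0 ≤ β * w := mul_nonneg hβ hw
  have hd1 : (1 : ℝ) ≤ (P.d : ℝ) := by exact_mod_cast P.hd
  have hM : 0 ≤ β * w * (2 * ((P.d : ℝ) - 1)) := mul_nonneg hβw (by linarith)
  have hε1 : ε ≤ 1 := by linarith
  have hρ2 : 2 * ρ ^ 2 ≤ 1 := by nlinarith
  -- the numeric modulus
  have hmuM := gnoMu_smallField_ge (M := β * w * (2 * ((P.d : ℝ) - 1))) hM hε8 hρ hρ4
  have hB₀ := T4GnomonicWilsonHessian.HessianBoundOn.of_le (hessianBoundOn_disjRep_self hβw hε0 hε1 e hsf₀ hρ hρ2 h3S)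
    hmuM
  have hB₁ := T4GnomonicWilsonHessian.HessianBoundOn.of_le (hessianBoundOn_disjRep hβw hε0 hε1 e hsf₁ hρ hρ2 h3S)
    hmuM
  -- the window floor makes the modulus positive
  have h3S16 : 3 * S' ^ 2 ≤ 1 / 16 := by nlinarith
  have hlam : 0 < gnoKappa S' + 7 / 25 * (β * w * (2 * ((P.d : ℝ) - 1))) := by
    have hk := gnoKappa_window_ge h3S16
    have h0 : 0 ≤ 7 / 25 * (β * w * (2 * ((P.d : ℝ) - 1))) := mul_nonneg (by norm_num) hM
    linarith
  refine mem_respDom_of_gnoChart_local e hS hSS' hS'1 hhm hC hK hdev hlam (contDiff_disjRep e (-β) w)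
    (contDiff_disjRep e (-β) w) hB₀ hB₁ (fun x _ => disjRep_eq hdis e (-β) w x) (fun x _ => disjRep_eq hdis e (-β) w x)
    (fun x hx => ?_) hBm hBg
  -- the gradient gap in staple currency
  have hx' : ∀ b : ↥s, blockProj e b x ⬝ᵥ blockProj e b x ≤ ρ ^ 2 :=
    fun b => (blockProj_dotProduct_self_le e hSS'.le hx b).trans h3S
  refine (coordGradient_disjRep_sub_sq_le_stapleDist e (-β) w hρ hx').trans ?_
  rw [show |(-β) * w| = β * w by rw [neg_mul, abs_neg, abs_of_nonneg hβw]]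
  have hD : 0 ≤ ∑ b : ↥s, stapleDist b u₀ u := Finset.sum_nonneg fun b _ => stapleDist_nonneg _ _ _
  exact pow_le_pow_left₀ (mul_nonneg (mul_nonneg hβw (by positivity)) hD) hgapD 2

/-- **THE CONCRETE DISJOINT-FIBRE COROLLARY.**  The parent plug for `h = fun U => −β * wilsonAction w U` through a
plaquette-disjoint fibre `s` with the deviation functional `dev := Σ_{b ∈ s} stapleDist b u₀`, the explicit slope
`β·w·(1+ρ+ρ²)/√λ`, `λ = gnoKappa S' + 7/25·(β·w·2(d−1))`, the PER-LINK window `3·S'² ≤ ρ²`, and field hypotheses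
on the REFERENCE exterior only: `reTr(u₀(∂p)) ≥ 1 − ε` on the plaquettes through the links of `s` and
`ε + Σ_{b ∈ s} stapleDist b u₀ u ≤ 1/8` (`reTr_update_ge_of_stapleDist` per link). [folklore] -/
theorem mem_respDom_of_wilson_disjoint {ι : Type*} (hdis : PlaqDisjoint s) (e : ↥s × Fin 3 ≃ Fin n) {S : ℝ}
    (hS : 0 < S) {S' : ℝ} (hSS' : S < S') (hS'1 : S' ≤ 1) {β w : ℝ} (hβ : 0 ≤ β) (hw : 0 ≤ w)
    (hhm : Measurable fun U : GaugeField P j SU2 => -β * wilsonAction w U) {C : ℝ}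
    (hC : ∀ U, windowDensity s u₀ S U * Real.exp (-β * wilsonAction w U) ≤ C) {K : ℝ}
    (hK : ∀ y : ↥s → SU2,
      |(-β * wilsonAction w (updateFinset u₀ s y)) - (-β * wilsonAction w (updateFinset u s y))| ≤ K)
    {ε : ℝ} (hε0 : 0 ≤ ε) (hεD : ε + ∑ b : ↥s, stapleDist b u₀ u ≤ 1 / 8)
    (hsf₀ : ∀ b ∈ s, ∀ p, IsLetter b p → 1 - ε ≤ reTr (GaugeField.plaqHol u₀ p))
    {ρ : ℝ} (hρ : 0 ≤ ρ) (hρ4 : ρ ≤ 1 / 4) (h3S : 3 * S' ^ 2 ≤ ρ ^ 2)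
    {B : (↥s → SU2) → ι → ℝ} {T : Finset ι} (hBm : ∀ i ∈ T, Measurable fun y => B y i) {L : ℝ}
    (hBg : ∀ i ∈ T, ∃ g : (Fin n → ℝ) → ℝ, ContDiff ℝ 1 g ∧
      (∀ x ∈ cube n S, g x = B (gnoFibreChart s u₀ e x) i) ∧
      ∀ x ∈ cube n S, coordGradient g x ⬝ᵥ coordGradient g x ≤ L ^ 2) :
    u ∈ respDom s (windowDensity s u₀ S) (fun U => -β * wilsonAction w U) u₀ B T
      (fun U => ∑ b : ↥s, stapleDist b u₀ U)
      (β * w * (1 + ρ + ρ ^ 2) / Real.sqrt (gnoKappa S' + 7 / 25 * (β * w * (2 * ((P.d : ℝ) - 1)))))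
      (L / Real.sqrt (gnoKappa S' + 7 / 25 * (β * w * (2 * ((P.d : ℝ) - 1))))) := by
  have hD : 0 ≤ ∑ b : ↥s, stapleDist b u₀ u := Finset.sum_nonneg fun b _ => stapleDist_nonneg _ _ _
  have hDb : ∀ b ∈ s, stapleDist b u₀ u ≤ ∑ b : ↥s, stapleDist b u₀ u := by
    intro b hb
    have h := Finset.single_le_sum (s := (Finset.univ : Finset ↥s))
      (f := fun b' : ↥s => stapleDist (b' : PBond P j) u₀ u) (fun b' _ => stapleDist_nonneg _ _ _)
      (Finset.mem_univ ⟨b, hb⟩)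
    exact h
  have hsf₀' : ∀ b ∈ s, ∀ p, IsLetter b p → 1 - (ε + ∑ b : ↥s, stapleDist b u₀ u) ≤ reTr (GaugeField.plaqHol u₀ p) :=
    fun b hb p hL => (sub_le_sub_left (le_add_of_nonneg_right hD) 1).trans (hsf₀ b hb p hL)
  have hsf₁' : ∀ b ∈ s, ∀ p, IsLetter b p →
      1 - (ε + ∑ b : ↥s, stapleDist b u₀ u) ≤ reTr (GaugeField.plaqHol (Function.update u b (u₀ b)) p) :=
    fun b hb p hL => (sub_le_sub_left (add_le_add (le_refl ε) (hDb b hb)) 1).trans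
      (reTr_update_ge_of_stapleDist (u := u) (hsf₀ b hb) p hL)
  have hε : 0 ≤ ε + ∑ b : ↥s, stapleDist b u₀ u := add_nonneg hε0 hD
  -- (the `by exact` wrappers keep the unifier from delta-unfolding `Finset.sum` against the `dev` β-redex)
  exact mem_respDom_of_wilson_disjoint_datum hdis e hS hSS' hS'1 hβ hw hhm hC hK
    (dev := fun U => ∑ b : ↥s, stapleDist b u₀ U) (by exact hD) hε hεD hsf₀' hsf₁' hρ hρ4 h3S
    (bH := β * w * (1 + ρ + ρ ^ 2)) (by exact le_rfl) hBm hBg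

/-! ## §7  Consistency with the one-link representative of `T4GnomonicWilsonHessian` -/

omit [DecidableEq (PBond P j)] in
/-- For `s = {b}` the block coordinates are the link coordinates. [folklore] -/
theorem blockProj_singleton (b : PBond P j) (e : ↥({b} : Finset (PBond P j)) × Fin 3 ≃ Fin n) (x : Fin n → ℝ) :
    blockProj e ⟨b, Finset.mem_singleton_self b⟩ x = linkCoord e x := rfl

/-- The one-link constant `κ` of `linkAffine_wilsonAction` is `c·A_w(u) − Re(q(u b) · wilsonDatum c w u b)`
(evaluate the affinity at `g = u b`). [folklore] -/
theorem wilsonKappa_eq (c w : ℝ) (u : GaugeField P j SU2) (b : PBond P j) :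
    wilsonKappa c w u b = c * wilsonAction w u - (su2Quat (u b) * wilsonDatum c w u b).re := by
  have h := linkAffine_wilsonAction c w u b (u b)
  dsimp only at h
  rw [Function.update_eq_self] at h
  linarith

/-- **ON THE ONE-LINK FIBRE THE REPRESENTATIVE IS THE ONE-LINK REPRESENTATIVE** `T4GnomonicWilsonHessian.linkRep` with
the Wilson datum `(wilsonKappa c w u b, wilsonDatum c w u b)` of `T4WilsonLinkAffine` — the multi-link object extends,
and does not re-derive, the one-link chain. [folklore] -/
theorem disjRep_singleton (b : PBond P j) (e : ↥({b} : Finset (PBond P j)) × Fin 3 ≃ Fin n) (c w : ℝ) :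
    disjRep {b} e u₀ u c w = linkRep e u₀ (wilsonKappa c w u b) (wilsonDatum c w u b) := by
  funext x
  rw [disjRep, disjConst, linkRep, sum_coe_singleton, sum_coe_singleton, gnoProfile_linkVec, wilsonKappa_eq,
    blockProj_singleton]
  simp only [blockDatum]
  ring

/-- Non-vacuity of the per-link data hypotheses at the FLAT reference field `u₀ = u = 1`, `ε = 0`: every plaquette
has `reTr 1(∂p) = 1 ≥ 1 − 0`, so `hessianBoundOn_disjRep_self` applies to every plaquette-disjoint `s` with modulus
`gnoMu(β·w·2(d−1), 0, ρ)`. [folklore] -/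
example {β w : ℝ} (hβw : 0 ≤ β * w) (e : ↥s × Fin 3 ≃ Fin n) {S' ρ : ℝ} (hρ : 0 ≤ ρ) (hρ2 : 2 * ρ ^ 2 ≤ 1)
    (h3S : 3 * S' ^ 2 ≤ ρ ^ 2) :
    HessianBoundOn (disjRep s e (1 : GaugeField P j SU2) 1 (-β) w) (cube n S')
      (gnoMu (β * w * (2 * ((P.d : ℝ) - 1)) * (1 - 0)) (β * w * (2 * ((P.d : ℝ) - 1)) * Real.sqrt (2 * 0)) ρ) :=
  hessianBoundOn_disjRep_self hβw le_rfl zero_le_one e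
    (fun b _ p _ => by
      change 1 - 0 ≤ reTr ((1 : SU2) * 1 * 1⁻¹ * 1⁻¹)
      simp [GaugeGroup.reTr_one]) hρ hρ2 h3S

/-- Non-vacuity of the deviation side of `mem_respDom_of_wilson_disjoint`: at the reference exterior itself every
`stapleDist` vanishes, so its field hypotheses reduce to `reTr(u₀(∂p)) ≥ 7/8` on the plaquettes through `s`.
[folklore] -/
example {ε : ℝ} (hε : ε ≤ 1 / 8) : ε + ∑ b : ↥s, stapleDist b u₀ u₀ ≤ 1 / 8 := by
  simp only [T4WilsonStapleDeviation.stapleDist_self, Finset.sum_const_zero, add_zero]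
  exact hε

end Literature.MathematicalPhysics.QuantumFieldTheory.Balaban1983to89.T4WilsonDisjointLinks

end
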